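import Summits.HodgeConjecture.HodgeConjecture.Theorems.VHCAbelianSchemesRoadDesignDefs
import Summits.HodgeConjecture.HodgeConjecture.Theorems.VHCAbelianSchemesRoadDiagonal
import Summits.HodgeConjecture.HodgeConjecture.Theorems.VHCAbelianSchemesRoadLefschetzSlackPin
import Literature.AlgebraicGeometry.Motives.ConstantFamilyFibre
import Literature.AlgebraicGeometry.Motives.AbelianVarietyRationalCurvesProofs
import Literature.AlgebraicGeometry.HodgeTheory.IsoTransport
import Literature.AlgebraicGeometry.HodgeTheory.HodgeClassesIsogenyInvariance
import Literature.AlgebraicGeometry.HodgeTheory.QuasiProjectiveOfAffine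
import Literature.AlgebraicGeometry.HodgeTheory.AlgebraicClassesHodgeTypeHolds
import HarnessLib

/-!
# Road b02 (`VHCAbelianSchemesRoad`) — A CELL IMPLIES THE DESIGN PROBLEM MODULO LEFSCHETZ CLASSES ON ONE ABELIAN VARIETY (necessary side)

research route conditional on HC_CM; not a corollary; Q11.4-sentence-2 already refuted in dim ≥ 3.

Door-generic and FACT-FREE. The cell `LefAtExceptionalRegimeAt 𝒪 n p` of the road's crux (regime 2 of K-SR♭∃ at relative dimension `n`,
codimension `p`) quantifies over ALL one-parameter abelian schemes of the crux's shape; among them is the CONSTANT PENCIL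
`pr₂ : X × 𝔸¹ ⟶ 𝔸¹` of any complex scheme `X` isomorphic to an abelian `n`-fold (smooth projective family of relative dimension `n` —
Literature `isSmoothProjectiveFamily_snd`; total space quasi-projective; base `𝔸¹ = Spec ℂ[t]` smooth, affine, irreducible, of dimension
`1`; section `(0_A ∘ !, 𝟙)`; every fibre `≅ X` by the slice isomorphism `sliceFiberIso`). Feeding it the pull-back `W := pr₁^* w` of a
rational algebraic class `w ∈ H^{2p}(X(ℂ); ℂ)` that is NOT an algebraic Lefschetz class — `W|_{(X × 𝔸¹)_s} = (slice_s⁻¹)^* w` is rational,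
`(p,p)`, algebraic and off `Dᵖ ⊗ ℂ` at EVERY fibre (iso transport) — the cell returns a fibre `s₁` and an `𝒪`-datum on the copy
`(X × 𝔸¹)_{s₁} ≅ X` with `κ_p = (a·W + Z)|_{s₁} = slice⁻¹^*(a·w + z)`, `z := slice^*(Z|_{s₁})` an algebraic Lefschetz class of `X`, and every
`κ_q` of type `(q,q)`:

* §1 the affine line `Spec ℂ[t]` as a base of the crux's shape (irreducible, affine, smooth, `dim = 1`, quasi-projective, a `ℂ`-point);
* §2 the constant pencil over it satisfies the binders (`isQuasiProjectiveOver_tensor_affineLine`, `exists_section_snd`, fibres `≅ X`) and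
  the restriction formula `map_fiberι_map_fst_eq`;
* §3 **`designModLefschetzAt_of_lefAtExceptionalRegimeAt : LefAtExceptionalRegimeAt 𝒪 n p → DesignModLefschetzAt 𝒪 n p`** and the same
  from the full cell statement `AdmissibleRepresentativesLefAtDeg 𝒪 n p`; for a door that RESPECTS ISOMORPHISMS (hypothesis displayed) the
  datum is moved back to `X` itself (`design_on_self_of_designModLefschetzAt_of_respectsIso`);
* §4 at a variety with `B¹ = ℚ·θ` the necessary design is PINNED in degree `p` (`κ_p = e^*(a·w + c·θᵖ)`; PART V's
  `divisorClassesSpan_le_span_cupPowTwo`) — the residual slack of the sandwich is the side degrees (`(q,q)` vs `ℂ·θ^q`) and the copy.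

So EVERY cell of the road is SANDWICHED between two statements about ONE abelian variety at a time (with the companion file
`VHCAbelianSchemesRoadDesignSufficient`): `PinnedHodgeDesignAt 𝒪 n p ⟹ LefAtExceptionalRegimeAt 𝒪 n p ⟹ DesignModLefschetzAt 𝒪 n p`; a
refutation of the last at ONE pair `(X, w)` — an abelian `n`-fold and a rational algebraic non-Lefschetz class of codimension `p` admitting
NO `𝒪`-datum with `κ_p ≡ a·w (mod Dᵖ ⊗ ℂ)`, `a ≠ 0`, on any copy of `X` — refutes the cell, hence the crux
`SemiregularSheafRepresentativesTwAtDiag` when `(n, p) = (2m, m)`, `m ≥ 2` (items file). What is NOT claimed: any design problem, any cell,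
K-SR♭∃, VHC, `HC_AV`, HC; `HC_CM` occurs nowhere. References: [cite: Bloch1972Semiregularity, Remark (7.5)] [cite: BuchweitzFlenner2003, §5
Thm. 5.1] [cite: vanGeemen1994HodgeAV, §2.4 and Thm. 4.11] [cite: Hartshorne1977, II.3 (p. 89) and III §10 Example 10.0.1].
-/

noncomputable section

open CategoryTheory CategoryTheory.Limits AlgebraicGeometry Topology MonoidalCategory CartesianMonoidalCategory

-- the cell's namespace repeats the summit name (`Summit.HodgeConjecture.HodgeConjecture…`), as in every `Ring2*` file
set_option linter.dupNamespace false

namespace Summit.HodgeConjecture.HodgeConjecture.Ring2.SemiregularRepresentatives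

open Literature.AlgebraicGeometry Literature.AlgebraicGeometry.Motives
open Literature.AlgebraicGeometry.HodgeTheory
open Literature.AlgebraicTopology.SingularHomology
open Literature.Barriers.HodgeConjecture (divisorClassesSpan)
open Summit.Ventures.HSemireg (ObjClass)

/-! ## §1 The affine line `Spec ℂ[t]` as a base of the crux's shape -/

/-- `𝔸¹_ℂ = Spec ℂ[t]` is irreducible (`ℂ[t]` is a domain). [cite: Hartshorne1977, II Example 3.2.1] -/
theorem irreducibleSpace_affineLine_left : IrreducibleSpace (specOver ℂ (MvPolynomial (Fin 1) ℂ)).left :=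
  inferInstanceAs (IrreducibleSpace (PrimeSpectrum (MvPolynomial (Fin 1) ℂ)))

/-- `𝔸¹_ℂ = Spec ℂ[t]` is affine. [cite: Hartshorne1977, II Example 3.2.1] -/
theorem isAffine_affineLine_left : IsAffine (specOver ℂ (MvPolynomial (Fin 1) ℂ)).left :=
  inferInstanceAs (IsAffine (Spec _))

/-- `𝔸¹_ℂ → Spec ℂ` is smooth (the tree's `smooth_specOver_mvPolynomial`). [cite: Hartshorne1977, III §10 Example 10.0.1] -/
theorem smooth_affineLine_hom : Smooth (specOver ℂ (MvPolynomial (Fin 1) ℂ)).hom :=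
  smooth_specOver_mvPolynomial 1

/-- `dim 𝔸¹_ℂ = 1` (topological Krull dimension of `Spec ℂ[t]` = Krull dimension of `ℂ[t]` = `0 + 1`).
[cite: Hartshorne1977, II Example 3.2.1 and I Prop. 1.9] -/
theorem topologicalKrullDim_affineLine_left : topologicalKrullDim (specOver ℂ (MvPolynomial (Fin 1) ℂ)).left = 1 := by
  change topologicalKrullDim (PrimeSpectrum (MvPolynomial (Fin 1) ℂ)) = 1
  rw [PrimeSpectrum.topologicalKrullDim_eq_ringKrullDim, MvPolynomial.ringKrullDim_of_isNoetherianRing,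
    ringKrullDim_eq_zero_of_field]
  simp

/-- `𝔸¹_ℂ` is quasi-projective over `ℂ` (affine of finite type; the tree's `IsQuasiProjectiveOver.of_isAffine`).
[cite: Hartshorne1977, II §4 (p. 103)] -/
theorem isQuasiProjectiveOver_affineLine : IsQuasiProjectiveOver (specOver ℂ (MvPolynomial (Fin 1) ℂ)) := by
  haveI : IsAffine (specOver ℂ (MvPolynomial (Fin 1) ℂ)).left := isAffine_affineLine_left
  haveI : Smooth (specOver ℂ (MvPolynomial (Fin 1) ℂ)).hom := smooth_affineLine_hom
  exact IsQuasiProjectiveOver.of_isAffine _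

/-- The origin `t = 0` of `𝔸¹_ℂ`, a complex point (`ℂ[t] → ℂ`, `t ↦ 0`). [cite: Hartshorne1977, II.2 Ex. 2.7] -/
theorem nonempty_complexPoints_affineLine : Nonempty (ComplexPoints (specOver ℂ (MvPolynomial (Fin 1) ℂ))) :=
  ⟨specOverOfAlgHom (MvPolynomial.aeval fun _ ↦ (0 : ℂ))⟩

/-! ## §2 The constant pencil `pr₂ : X × 𝔸¹ ⟶ 𝔸¹` satisfies the binders of the crux -/

variable {X : SchemeOver ℂ}

/-- **`X × C` is quasi-projective for `X` projective and `C` quasi-projective** (`X ◁ j : X × C ⟶ X × P` is an open immersion, base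
change of the open immersion `j : C ↪ P` into a projective `P`; `X × P` is projective by Segre). [cite: Hartshorne1977, II Ex. 4.9 and §4 (p. 103)] -/
theorem isQuasiProjectiveOver_tensor_of_isProjectiveOver (hX : IsProjectiveOver X) {C : SchemeOver ℂ} (hC : IsQuasiProjectiveOver C) :
    IsQuasiProjectiveOver (X ⊗ C) := by
  obtain ⟨P, j, hP, hj⟩ := hC
  refine ⟨X ⊗ P, X ◁ j, hX.tensor hP, ?_⟩
  haveI := hj
  have hsq : IsPullback (snd X C).left (X ◁ j).left j.left (snd X P).left :=
    (isPullback_snd_whiskerLeft j X).map (Over.forget _)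
  exact MorphismProperty.of_isPullback (P := @IsOpenImmersion) hsq hj

/-- **The constant pencil has a section** `(x₀ ∘ !, 𝟙_C)` through any `ℂ`-morphism `x₀ : 𝟙 ⟶ X` (here the unit of an abelian variety
`A` with `A.X ≅ X`). [cite: Hartshorne1977, II.3 (p. 89)] [cite: MumfordAV1970, §4 (definition)] -/
theorem exists_section_snd (A : AbelianVariety ℂ) (e : A.X ≅ X) (C : SchemeOver ℂ) :
    ∃ σ : C ⟶ X ⊗ C, σ ≫ snd X C = 𝟙 C :=
  ⟨lift (toUnit C ≫ MonObj.one ≫ e.hom) (𝟙 C), lift_snd _ _⟩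

/-- **Restriction to a fibre of the constant pencil is pull-back along the inverse slice isomorphism**: for `w ∈ Hᵏ(X(ℂ); ℂ)`,
`(pr₁^* w)|_{(X × C)_s} = (slice_s⁻¹)^* w`, where `slice_s : X ≅ (X × C)_s` (`slice_s ≫ ι_s ≫ pr₁ = 𝟙_X`).
[cite: Hartshorne1977, II.3 (p. 89)] [cite: HatcherAT2002, Prop. 3.10] -/
theorem map_fiberι_map_fst_eq {C : SchemeOver ℂ} (s : ComplexPoints C) (k : ℕ) (w : complexBetti X k) :
    complexBetti.map (fiberι (snd X C) s) k (complexBetti.map (fst X C) k w) =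
      complexBetti.map (sliceFiberIso X s).inv k w := by
  have h1 : fiberι (snd X C) s ≫ fst X C = (sliceFiberIso X s).inv :=
    ((sliceFiberIso X s).hom_comp_eq_id).1 (by rw [sliceFiberIso_hom_fiberι_fst])
  rw [← h1, complexBetti.map_comp]
  rfl

/-! ## §3 A cell implies the design problem modulo Lefschetz classes -/

/-- **REGIME 2 AT `(n, p)` IMPLIES THE DESIGN PROBLEM MODULO LEFSCHETZ CLASSES ON ONE ABELIAN VARIETY** (door-generic, fact-free): run the
cell on the constant pencil `pr₂ : X × 𝔸¹ ⟶ 𝔸¹` with `W := pr₁^* w` (rational, `(p,p)`, algebraic and — `w ∉ Dᵖ(X) ⊗ ℂ` — non-Lefschetz on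
EVERY fibre, so the regime-2 hypothesis holds at the origin); the datum it returns at a fibre `s₁` lives on the copy `(X × 𝔸¹)_{s₁} ≅ X`
with `κ_p = (a·W + Z)|_{s₁} = slice⁻¹^*(a·w + slice^*(Z|_{s₁}))`, `slice^*(Z|_{s₁})` an algebraic Lefschetz class of `X`, `κ_q = V_q|_{s₁}` of
type `(q,q)`. [cite: Bloch1972Semiregularity, Remark (7.5)] [cite: vanGeemen1994HodgeAV, §2.4] [cite: Hartshorne1977, II.3 (p. 89)] -/
theorem designModLefschetzAt_of_lefAtExceptionalRegimeAt {𝒪 : ObjClass} {n p : ℕ} (h : LefAtExceptionalRegimeAt 𝒪 n p) :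
    DesignModLefschetzAt 𝒪 n p := by
  intro X hXab w hwQ hwalg hwD
  obtain ⟨A, hA, ⟨eA⟩⟩ := hXab
  have hAX : IsSmoothProjective n A.X := hA ▸ AbelianVariety.isSmoothProjective_holds (A := A)
  have hX : IsSmoothProjective n X := hAX.of_iso eA
  have hwH : IsOfHodgeType n X (2 * p) p p w := isOfHodgeType_of_mem_algebraicClasses_of_isSmoothProjective hX p hwalg
  -- the base `C = 𝔸¹`
  haveI : IrreducibleSpace (specOver ℂ (MvPolynomial (Fin 1) ℂ)).left := irreducibleSpace_affineLine_left
  haveI : IsAffine (specOver ℂ (MvPolynomial (Fin 1) ℂ)).left := isAffine_affineLine_left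
  obtain ⟨s₀⟩ := nonempty_complexPoints_affineLine
  -- the constant pencil and its binders
  have hf : IsSmoothProjectiveFamily (snd X (specOver ℂ (MvPolynomial (Fin 1) ℂ))) n :=
    isSmoothProjectiveFamily_snd hX _
  have h𝒳 : IsQuasiProjectiveOver (X ⊗ specOver ℂ (MvPolynomial (Fin 1) ℂ)) :=
    isQuasiProjectiveOver_tensor_of_isProjectiveOver hX.isProjectiveOver isQuasiProjectiveOver_affineLine
  have habel : ∀ s : ComplexPoints (specOver ℂ (MvPolynomial (Fin 1) ℂ)),
      ∃ A' : AbelianVariety ℂ, A'.dim = n ∧ Nonempty (A'.X ≅ fiberOver (snd X (specOver ℂ (MvPolynomial (Fin 1) ℂ))) s) :=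
    fun s ↦ ⟨A, hA, ⟨eA ≪≫ sliceFiberIso X s⟩⟩
  -- the class `W := pr₁^* w` and its restrictions
  have hres := fun s : ComplexPoints (specOver ℂ (MvPolynomial (Fin 1) ℂ)) ↦ map_fiberι_map_fst_eq s (2 * p) w
  have hW : ∀ s : ComplexPoints (specOver ℂ (MvPolynomial (Fin 1) ℂ)),
      IsRationalClass (complexBetti.map (fiberι (snd X _) s) (2 * p) (complexBetti.map (fst X _) (2 * p) w)) ∧
        IsOfHodgeType n (fiberOver (snd X _) s) (2 * p) p p
          (complexBetti.map (fiberι (snd X _) s) (2 * p) (complexBetti.map (fst X _) (2 * p) w)) := by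
    intro s
    rw [hres s]
    exact ⟨(isRationalClass_map_iff_of_iso (sliceFiberIso X s).symm).2 hwQ,
      (isOfHodgeType_map_iff_of_iso (sliceFiberIso X s).symm).2 hwH⟩
  have hWs₀ : complexBetti.map (fiberι (snd X _) s₀) (2 * p) (complexBetti.map (fst X _) (2 * p) w) ∈
      algebraicClasses (fiberOver (snd X (specOver ℂ (MvPolynomial (Fin 1) ℂ))) s₀) p := by
    rw [hres s₀]
    exact (mem_algebraicClasses_map_iff_of_iso (sliceFiberIso X s₀).symm).2 hwalg
  have hexc : ¬ ∀ s : ComplexPoints (specOver ℂ (MvPolynomial (Fin 1) ℂ)),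
      complexBetti.map (fiberι (snd X _) s) (2 * p) (complexBetti.map (fst X _) (2 * p) w) ∈
          algebraicClasses (fiberOver (snd X _) s) p ∧
        complexBetti.map (fiberι (snd X _) s) (2 * p) (complexBetti.map (fst X _) (2 * p) w) ∈
          divisorClassesSpan (fiberOver (snd X _) s) n p := by
    intro hall
    obtain ⟨-, hD⟩ := hall s₀
    apply hwD
    have hback := map_mem_divisorClassesSpan hX (hf.isSmoothProjective s₀) (sliceFiberIso X s₀).hom hD
    rwa [hres s₀, (sliceFiberIso X s₀).complexBetti_map_hom_map_inv] at hback
  obtain ⟨s₁, I, κ, V, a, Z, hpI, h𝒪, ha, hZ, hV, hκV, hVH⟩ :=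
    h (snd X _) hf h𝒳 irreducibleSpace_affineLine_left isAffine_affineLine_left smooth_affineLine_hom
      topologicalKrullDim_affineLine_left habel (exists_section_snd A eA _) _ hW s₀ hWs₀ hexc
  refine ⟨fiberOver (snd X _) s₁, (sliceFiberIso X s₁).symm, I, κ, a,
    complexBetti.map (sliceFiberIso X s₁).hom (2 * p) (complexBetti.map (fiberι (snd X _) s₁) (2 * p) Z),
    hpI, h𝒪, ha, ?_, ?_, ?_, fun q hq ↦ ?_⟩
  · exact (mem_algebraicClasses_map_iff_of_iso (sliceFiberIso X s₁)).2 (hZ s₁).1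
  · exact map_mem_divisorClassesSpan hX (hf.isSmoothProjective s₁) (sliceFiberIso X s₁).hom (hZ s₁).2
  · rw [hκV p hpI, hV, map_add, map_smul, hres s₁, Iso.symm_hom, map_add, map_smul,
      (sliceFiberIso X s₁).complexBetti_map_inv_map_hom]
  · rw [hκV q hq]
    exact hVH q hq s₁

/-- **The full cell statement `AdmissibleRepresentativesLefAtDeg 𝒪 n p` (both regimes) implies the design problem modulo Lefschetz
classes** (through regime 2). [cite: Bloch1972Semiregularity, Remark (7.5)] [cite: vanGeemen1994HodgeAV, §2.4] -/
theorem designModLefschetzAt_of_admissibleRepresentativesLefAtDeg {𝒪 : ObjClass} {n p : ℕ} (h : AdmissibleRepresentativesLefAtDeg 𝒪 n p) :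
    DesignModLefschetzAt 𝒪 n p :=
  designModLefschetzAt_of_lefAtExceptionalRegimeAt (lefAtExceptionalRegimeAt_of_admissibleRepresentativesLefAtDeg h)

/-- **K-SR♭∃ for the door (ungraded) implies the design problem modulo Lefschetz classes in every bidegree.**
[cite: Bloch1972Semiregularity, Remark (7.5)] [cite: vanGeemen1994HodgeAV, §2.4] -/
theorem designModLefschetzAt_of_admissibleRepresentativesLefAt {𝒪 : ObjClass} (h : AdmissibleRepresentativesLefAt 𝒪) (n p : ℕ) :
    DesignModLefschetzAt 𝒪 n p :=
  designModLefschetzAt_of_admissibleRepresentativesLefAtDeg (admissibleRepresentativesLefAt_iff_forall_deg.1 h n p)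

/-- **For a door that RESPECTS ISOMORPHISMS the datum lives on `X` itself.** If `𝒪`-admissibility transports along isomorphisms of
`ℂ`-schemes (hypothesis `h𝒪`; not assumed of a general object class), `DesignModLefschetzAt 𝒪 n p` gives, for every `(X, w)` as there, an
`𝒪`-datum ON `X` with `κ_p = a·w + z`, `a ≠ 0`, `z` an algebraic Lefschetz class, every `κ_q` of type `(q,q)`. [folklore]
[cite: Bloch1972Semiregularity, Remark (7.5)] -/
theorem design_on_self_of_designModLefschetzAt_of_respectsIso {𝒪 : ObjClass}
    (h𝒪 : ∀ (n : ℕ) ⦃Y Y' : SchemeOver ℂ⦄ (e : Y' ≅ Y) (I : Finset ℕ) (κ : (q : ℕ) → complexBetti Y (2 * q)),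
      𝒪 n Y I κ → 𝒪 n Y' I (fun q ↦ complexBetti.map e.hom (2 * q) (κ q)))
    {n p : ℕ} (h : DesignModLefschetzAt 𝒪 n p) (X : SchemeOver ℂ) (hX : ∃ A : AbelianVariety ℂ, A.dim = n ∧ Nonempty (A.X ≅ X))
    (w : complexBetti X (2 * p)) (hwQ : IsRationalClass w) (hwalg : w ∈ algebraicClasses X p) (hwD : w ∉ divisorClassesSpan X n p) :
    ∃ (I : Finset ℕ) (κ : (q : ℕ) → complexBetti X (2 * q)) (a : ℂ) (z : complexBetti X (2 * p)),
      p ∈ I ∧ 𝒪 n X I κ ∧ a ≠ 0 ∧ z ∈ algebraicClasses X p ∧ z ∈ divisorClassesSpan X n p ∧ κ p = a • w + z ∧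
      ∀ q ∈ I, IsOfHodgeType n X (2 * q) q q (κ q) := by
  obtain ⟨A, hA, ⟨eA⟩⟩ := hX
  have hAX : IsSmoothProjective n A.X := hA ▸ AbelianVariety.isSmoothProjective_holds (A := A)
  have hXsp : IsSmoothProjective n X := hAX.of_iso eA
  obtain ⟨X', e, I, κ, a, z, hpI, h𝒪', ha, hzalg, hzD, hκp, hκH⟩ := h X ⟨A, hA, ⟨eA⟩⟩ w hwQ hwalg hwD
  refine ⟨I, fun q ↦ complexBetti.map e.inv (2 * q) (κ q), a, z, hpI, h𝒪 n e.symm I κ h𝒪', ha, hzalg, hzD, ?_, fun q hq ↦ ?_⟩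
  · change complexBetti.map e.inv (2 * p) (κ p) = _
    rw [hκp, e.complexBetti_map_inv_map_hom]
  · exact (isOfHodgeType_map_iff_of_iso e.symm).2 (hκH q hq)

/-! ## §4 At Picard rank one the necessary design is PINNED in degree `p` -/

/-- **At a variety with `B¹ = ℚ·θ` the design modulo Lefschetz classes is pinned in degree `p`.** If every rational `(1,1)`-class of
`H²(X(ℂ); ℂ)` lies on `ℂ·θ` (Picard number one in Hodge form — a very general Weil-type member, van Geemen Thm. 4.11), then
`Dᵖ(X) ⊗ ℂ = ℂ·θᵖ` (PART V `divisorClassesSpan_le_span_cupPowTwo`), so the datum delivered by `DesignModLefschetzAt 𝒪 n p` at `(X, w)` reads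
`κ_p = e^*(a·w + c·θᵖ)`: in degree `p` exactly the PINNED design (`PinnedDesignAt`), the side components being only of type `(q,q)` (not on
the `θ`-ray) and the datum on a copy of `X` — this is the residual slack of the sandwich. [cite: vanGeemen1994HodgeAV, Thm. 4.11 and §2.4]
[cite: Bloch1972Semiregularity, Remark (7.5)] -/
theorem exists_pinned_of_designModLefschetzAt_of_picardRankOne {𝒪 : ObjClass} {n p : ℕ} (h : DesignModLefschetzAt 𝒪 n p)
    (X : SchemeOver ℂ) (hX : ∃ A : AbelianVariety ℂ, A.dim = n ∧ Nonempty (A.X ≅ X)) (θ : complexBetti X 2)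
    (hpic : ∀ b : complexBetti X 2, IsRationalClass b → IsOfHodgeType n X 2 1 1 b → b ∈ ℂ ∙ θ)
    (w : complexBetti X (2 * p)) (hwQ : IsRationalClass w) (hwalg : w ∈ algebraicClasses X p) (hw : w ∉ ℂ ∙ cupPowTwo θ p) :
    ∃ (X' : SchemeOver ℂ) (e : X' ≅ X) (I : Finset ℕ) (κ : (q : ℕ) → complexBetti X' (2 * q)) (a c : ℂ),
      p ∈ I ∧ 𝒪 n X' I κ ∧ a ≠ 0 ∧ κ p = complexBetti.map e.hom (2 * p) (a • w + c • cupPowTwo θ p) ∧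
      ∀ q ∈ I, IsOfHodgeType n X' (2 * q) q q (κ q) := by
  have hD : divisorClassesSpan X n p ≤ ℂ ∙ cupPowTwo θ p := divisorClassesSpan_le_span_cupPowTwo hpic p
  have hwD : w ∉ divisorClassesSpan X n p := fun hw' ↦ hw (hD hw')
  obtain ⟨X', e, I, κ, a, z, hpI, h𝒪, ha, -, hzD, hκp, hκH⟩ := h X hX w hwQ hwalg hwD
  obtain ⟨c, hc⟩ := Submodule.mem_span_singleton.1 (hD hzD)
  exact ⟨X', e, I, κ, a, c, hpI, h𝒪, ha, by rw [hκp, ← hc], hκH⟩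

end Summit.HodgeConjecture.HodgeConjecture.Ring2.SemiregularRepresentatives

end
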